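import Mathlib
import Summits.Ventures.HodgeRepro2.T5DecompositionTrivial

/-!
# «`p` splits completely ⇒ every CM type is `p`-ordinary» in Galois-group vocabulary

Blind cell `pub-hodge-repro2`, seat p7 (gen 9), Tier-5 kernel support for N5 / §G S0
(route/T5-CHECK-G-p7.md S0: «p splits completely in E ⇒ every CM type Σ_i is p-ordinary»;
§12.2 row P1.5: Hsieh's (ord) «Σ is a CM type of K such that the p-adic places induced by elements
in Σ via ι_p are disjoint from those induced by elements in Σc», i.e. `Σ_p ∩ Σ_pc = ∅` and
`Σ_p ∪ Σ_pc = {places above p}`).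

Vocabulary: `G` a Galois group of `S/R` (`IsGaloisGroup G R S`), `P` a prime of `S` over `p`;
for `σ ∈ G` the prime «induced by the embedding `ι_p ∘ σ`» is `inducedPrime P σ := σ⁻¹ • P`
(`P` = the prime induced by `ι_p` itself); a CM type, read in `G`, is a subset `T` with
`T ∩ cT = ∅` and `T ∪ cT = G` for the central involution `c` (complex conjugation).  Then

* `inducedPrime_injective_of_degree_one`: at `e · f = 1` distinct `σ` induce distinct primes
  (`T5DecompositionTrivial`);
* `disjoint_inducedPrimes_smul_of_degree_one`: `T ∩ cT = ∅ ⇒ Σ_p ∩ Σ_pc = ∅` — every CM type is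
  `p`-ordinary when `p` splits completely (the conclusion of S0 / the (ord) hypothesis of P1.5);
* `inducedPrimes_univ_eq_primesOver`, `inducedPrimes_union_smul_eq_primesOver`:
  `T ∪ cT = G ⇒ Σ_p ∪ Σ_pc = {primes over p}` (transitivity of `G`; no degree hypothesis).

What stays prose: the reading «place induced by `ι_p ∘ σ`» = `σ⁻¹ • P` (embeddings ↔ Galois
group) and that Hsieh's `Σ` (a set of embeddings `K → ℂ`) is this `T` (p1's `IsCMType` is the
embedding-side notion; nothing is re-declared here — `T` is any subset of `G`).
README §8(d): uses an L-value-free non-vanishing device: NO.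
-/

namespace Summit.Ventures.HodgeRepro2.T5OrdinaryCMType

open Ideal MulAction
open scoped Pointwise

section Induced

variable {S : Type*} [CommRing S] {G : Type*} [Group G] [MulSemiringAction G S]

/-- The prime «induced by the embedding `ι_p ∘ σ`»: `σ⁻¹ • P`, where `P` is the prime induced by
`ι_p`.  (Reading of print: `ι_p ∘ σ` pulls the maximal ideal of `ℂ_p` back to `σ⁻¹(P)`.) -/
def inducedPrime (P : Ideal S) (σ : G) : Ideal S := σ⁻¹ • P

/-- Unfolding `inducedPrime`. -/
theorem inducedPrime_apply (P : Ideal S) (σ : G) : inducedPrime P σ = σ⁻¹ • P := rfl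

/-- The identity embedding induces `P` itself. -/
theorem inducedPrime_one (P : Ideal S) : inducedPrime P (1 : G) = P := by
  simp [inducedPrime]

/-- `σ ↦ σ⁻¹ • P` is the orbit map composed with inversion. -/
theorem inducedPrime_eq_comp_inv (P : Ideal S) :
    (inducedPrime P : G → Ideal S) = (fun σ : G => σ • P) ∘ (fun σ : G => σ⁻¹) := rfl

/-- The set of primes induced by a set `T ⊆ G` of «embeddings»: `Σ_p`. -/
def inducedPrimes (P : Ideal S) (T : Set G) : Set (Ideal S) := inducedPrime P '' T

/-- `Σ_p` of a union is the union of the `Σ_p`. -/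
theorem inducedPrimes_union (P : Ideal S) (T T' : Set G) :
    inducedPrimes P (T ∪ T') = inducedPrimes P T ∪ inducedPrimes P T' :=
  Set.image_union _ _ _

/-- The primes induced by all of `G` form the orbit of `P`. -/
theorem inducedPrimes_univ_eq_orbit (P : Ideal S) :
    inducedPrimes P (Set.univ : Set G) = orbit G P := by
  ext Q
  constructor
  · rintro ⟨σ, -, rfl⟩
    exact ⟨σ⁻¹, rfl⟩
  · rintro ⟨σ, rfl⟩
    exact ⟨σ⁻¹, Set.mem_univ _, by simp [inducedPrime]⟩

end Induced

section DegreeOne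

variable {R S : Type*} [CommRing R] [CommRing S] [Algebra R S]
  (G : Type*) [Group G] [Finite G] [MulSemiringAction G S] [IsGaloisGroup G R S]
  (p : Ideal R) [p.IsPrime] (P : Ideal S) [P.IsPrime] [P.LiesOver p]

omit [p.IsPrime] in
/-- `Σ_p` over all of `G` is the set of ALL primes over `p` (transitivity; Mathlib's
`Algebra.IsInvariant.orbit_eq_primesOver`). -/
theorem inducedPrimes_univ_eq_primesOver :
    inducedPrimes P (Set.univ : Set G) = p.primesOver S := by
  rw [inducedPrimes_univ_eq_orbit, Algebra.IsInvariant.orbit_eq_primesOver R S G p P]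

omit [p.IsPrime] in
/-- `T ∪ cT = G ⇒ Σ_p ∪ Σ_pc = {primes over p}` (the covering half of (ord); no degree
hypothesis needed). -/
theorem inducedPrimes_union_smul_eq_primesOver (c : G) {T : Set G} (hT : T ∪ c • T = Set.univ) :
    inducedPrimes P T ∪ inducedPrimes P (c • T) = p.primesOver S := by
  rw [← inducedPrimes_union, hT, inducedPrimes_univ_eq_primesOver G p P]

variable [IsDomain R] [IsDomain S] [Module.Finite R S] [Module.Flat R S]
  [PerfectField p.ResidueField]

/-- At `e · f = 1`, distinct elements of `G` induce distinct primes
(`T5DecompositionTrivial.smul_injective_of_degree_one` composed with inversion). -/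
theorem inducedPrime_injective_of_degree_one (h : p.ramificationIdxIn S * p.inertiaDegIn S = 1) :
    Function.Injective (inducedPrime P : G → Ideal S) := by
  rw [inducedPrime_eq_comp_inv]
  exact (T5DecompositionTrivial.smul_injective_of_degree_one G p P h).comp inv_injective

/-- At `e · f = 1`, disjoint sets of «embeddings» induce disjoint sets of primes. -/
theorem disjoint_inducedPrimes_of_degree_one (h : p.ramificationIdxIn S * p.inertiaDegIn S = 1)
    {T T' : Set G} (hd : Disjoint T T') : Disjoint (inducedPrimes P T) (inducedPrimes P T') :=
  (Set.disjoint_image_iff (inducedPrime_injective_of_degree_one G p P h)).mpr hd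

/-- **«`p` splits completely ⇒ every CM type is `p`-ordinary»**: for `T ⊆ G` with `T ∩ cT = ∅`
(a CM type read in the Galois group, `c` = complex conjugation), at `e · f = 1` the primes
induced by `T` and by `cT` are disjoint — Hsieh's (ord) for `Σ = T` (CHECK-G S0, row P1.5). -/
theorem disjoint_inducedPrimes_smul_of_degree_one
    (h : p.ramificationIdxIn S * p.inertiaDegIn S = 1) (c : G) {T : Set G}
    (hT : Disjoint T (c • T)) : Disjoint (inducedPrimes P T) (inducedPrimes P (c • T)) :=
  disjoint_inducedPrimes_of_degree_one G p P h hT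

/-- Both halves of (ord) at once: a CM type `T` (`T ∩ cT = ∅`, `T ∪ cT = G`) induces a
PARTITION `Σ_p ⊔ Σ_pc` of the primes over `p` when `e · f = 1`. -/
theorem isOrdinary_of_degree_one (h : p.ramificationIdxIn S * p.inertiaDegIn S = 1) (c : G)
    {T : Set G} (hT : Disjoint T (c • T)) (hT' : T ∪ c • T = Set.univ) :
    Disjoint (inducedPrimes P T) (inducedPrimes P (c • T)) ∧
      inducedPrimes P T ∪ inducedPrimes P (c • T) = p.primesOver S :=
  ⟨disjoint_inducedPrimes_smul_of_degree_one G p P h c hT,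
    inducedPrimes_union_smul_eq_primesOver G p P c hT'⟩

end DegreeOne

end Summit.Ventures.HodgeRepro2.T5OrdinaryCMType
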